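import Summits.ABC.ABC.Theorems.DegreePrimesPolyBounded.Negative.Pump
import Summits.ABC.ABC.Theorems.IsogenyGlueCongruencePolyDegreeOfBoundedPrimesPolyDegreeOfDepthExistsOfCount
import Summits.ABC.ABC.Theorems.IsogenyGlueCongruencePolyDegreeOfBoundedPrimesPrimePowersExistOfExcessDepth
import Literature.NumberTheory.EllipticCurves.PastenSpectralDegreeIsogenyBoundProofs
import Literature.NumberTheory.EllipticCurves.EichlerShimuraConstruction
import Literature.NumberTheory.EllipticCurves.CuspFormLFunction
import Literature.NumberTheory.EllipticCurves.ModularParametrizationDegree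

/-!
# The minimal datum lies below every datum; exactness of the splitting of crux B (line `Sketch`)

Stub `stub_polyDegreeBelow_of_polyDegree` of the line `Sketch` of crux B = `PolyDegreeOfBoundedPrimes`
(stmt-ABC-2046, route IsogenyGlueCongruence), with the structural theorem behind it.

* `MinimalBelow.exists_modularDegree_eq_sq_mul` — **the degree of every modular parametrisation datum
  of `W` at level `N` is a non-zero square multiple of the degree of a minimal datum**: two data of `W`
  have the same newform (`IsNewformOf.unique`) and the same Néron lattice
  (`IsNeronLatticeOf.lattice_eq`), hence the same uniformisation; they differ only in the Manin
  constant `c`, the admissible constants (`c Λ_f ⊆ Λ_E`) form a subgroup of `ℤ`, so the `gcd` `g` of two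
  admissible constants is admissible and carries a datum (`exists_datum_c_eq`); degrees scale with the
  square of the constant (`deg_eq_sq_mul_deg`, the pumping lemma of `DegreePrimesPolyBounded/Negative/Pump`,
  made sign-insensitive here through the datum with constant `−c`, `MinimalBelow.exists_datum_neg`), and
  minimality forces the minimal datum to have the degree of the `gcd` datum. Corollaries
  `MinimalBelow.minModularDegree_dvd` (`d_min(W, N) ∣ deg D` for every datum `D`) and
  `MinimalBelow.exists_minimal_dvd`.
* `stub_polyDegreeBelow_of_polyDegree` (registered on stmt-ABC-2046) — `P → P∣`: the polynomial
  modular-degree statement in the tree's `∃ D` idiom implies its "below every datum" form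
  `∀ D₀ ∃ D, deg D ∣ deg D₀ ∧ deg D ≤ C N^κ` (take the minimal datum).
* Riders `MinimalBelow.primePowersBelow_of_polyDegreeBelow`, `MinimalBelow.excessDepthBelow_of_polyDegreeBelow`,
  `MinimalBelow.truncatedMassBelow_of_polyDegreeBelow` (`P∣` implies each arithmetic stub of the line) and
  the **exactness theorem** `polyDegreeOfBoundedPrimes_iff_excessDepth_and_truncatedMass`:
  crux B is EQUIVALENT to `A → DEPTH_A∣ ∧ COUNT∣` (skeleton v3's two open stubs), kernel-checked — the
  splitting of the line loses nothing.

Sources: folklore on top of tree theorems (`exists_datum_c_eq`, `IsNewformOf.unique`,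
`IsNeronLatticeOf.lattice_eq`, `φ_gamma0_smul_holds'`, `Negative.Pump.deg_eq_sq_mul_deg`); on paper this is
"every parametrisation factors through the optimal one followed by an isogeny" (Agashe–Ribet–Stein 2012 §1;
Knapp 1993 p. 300) in the tree's analytic language. No literature fact is used.
-/

noncomputable section

-- single-conjunct summit ABC: the duplicate ABC.ABC is mandated (CONVENTIONS §2)
set_option linter.dupNamespace false

namespace Summit.ABC.ABC.Theorems

open scoped MatrixGroups BigOperators
open Literature.NumberTheory.EllipticCurves.ModularForms CongruenceSubgroup UpperHalfPlane
open Summit.ABC.ABC.Theses.IsogenyGlueCongruence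

section Datum

variable {W : WeierstrassCurve ℚ} {N : ℕ} [NeZero N]

/-- **Negating the Manin constant.** A datum with constant `−c`, the same newform, period pair,
uniformisation and the same degree (`φ_{−c} = −φ_c`, so the fibre of `φ_{−c}` over `P` is the fibre of
`φ_c` over `−P`). [folklore] -/
theorem MinimalBelow.exists_datum_neg (D : ModularParametrizationData W N) :
    ∃ D' : ModularParametrizationData W N,
      D'.f = D.f ∧ D'.L = D.L ∧ D'.c = -D.c ∧ D'.deg = D.deg := by
  have e : ∀ τ : ℍ, D.uniformize (((-D.c : ℤ) : ℂ) * eichlerIntegral D.f τ) = -D.φ τ := by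
    intro τ
    show D.uniformize _ = -D.uniformize _
    rw [← map_neg]
    congr 1
    push_cast
    ring
  have hspec : {P : (W.baseChange ℂ).toAffine.Point |
      Nat.card {y : Y0 N // ∃ τ : ℍ, Y0.mk N τ = y ∧
        D.uniformize (((-D.c : ℤ) : ℂ) * eichlerIntegral D.f τ) = P} ≠ D.deg}.Finite := by
    have hset : {P : (W.baseChange ℂ).toAffine.Point |
        Nat.card {y : Y0 N // ∃ τ : ℍ, Y0.mk N τ = y ∧
          D.uniformize (((-D.c : ℤ) : ℂ) * eichlerIntegral D.f τ) = P} ≠ D.deg} =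
        (fun P ↦ -P) ⁻¹' {Q : (W.baseChange ℂ).toAffine.Point |
          Nat.card {y : Y0 N // ∃ τ : ℍ, Y0.mk N τ = y ∧ D.φ τ = Q} ≠ D.deg} := by
      ext P
      simp only [Set.mem_setOf_eq, Set.mem_preimage, e, neg_eq_iff_eq_neg]
    rw [hset]
    exact D.deg_spec.preimage neg_injective.injOn
  exact ⟨{ D with
      c := -D.c
      smul_periodLattice_le := fun z hz ↦ by
        have h := D.smul_periodLattice_le z hz
        have : ((-D.c : ℤ) : ℂ) * z = -((D.c : ℂ) * z) := by push_cast; ring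
        rw [this]
        exact D.L.lattice.neg_mem h
      deg := D.deg
      deg_pos := D.deg_pos
      deg_spec := hspec }, rfl, rfl, rfl, rfl⟩

/-- **Degrees scale with the square of the Manin constant, integer form** of
`Negative.Pump.deg_eq_sq_mul_deg`: same newform, same lattice and `c' = k c` with `k ∈ ℤ ∖ {0}` give
`deg' = |k|² · deg` (for `k < 0` pass to the datum with constant `−c`). [folklore] -/
theorem MinimalBelow.deg_eq_natAbs_sq_mul_deg (D D' : ModularParametrizationData W N)
    (hf : D'.f = D.f) (hL : D'.L.lattice = D.L.lattice) {k : ℤ} (hk : k ≠ 0) (hc : D'.c = k * D.c) :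
    D'.deg = k.natAbs ^ 2 * D.deg := by
  rcases le_or_gt 0 k with hk0 | hk0
  · have hkk : (k.natAbs : ℤ) = k := Int.natAbs_of_nonneg hk0
    exact DegreePrimesPolyBounded.Negative.deg_eq_sq_mul_deg D D' D.φ_gamma0_smul_holds' hf hL
      (Int.natAbs_ne_zero.mpr hk) (by rw [hkk]; exact hc)
  · obtain ⟨Dn, hnf, hnL, hnc, hndeg⟩ := MinimalBelow.exists_datum_neg D
    have hkk : (k.natAbs : ℤ) = -k := Int.ofNat_natAbs_of_nonpos hk0.le
    rw [← hndeg]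
    refine DegreePrimesPolyBounded.Negative.deg_eq_sq_mul_deg Dn D' Dn.φ_gamma0_smul_holds'
      (hf.trans hnf.symm) (by rw [hL, hnL]) (Int.natAbs_ne_zero.mpr hk) ?_
    rw [hkk, hnc, hc]
    ring

/-- **Every datum degree is a non-zero square multiple of the minimal degree.** If `Dm` has minimal
degree among the data of `W` at level `N`, then `deg D₀ = k² · deg Dm` with `k ≠ 0` for every datum `D₀`
(the `gcd` of the two Manin constants carries a datum, below both by the square law; minimality pins its
degree to `deg Dm`). [folklore] -/
theorem MinimalBelow.exists_modularDegree_eq_sq_mul (D₀ Dm : ModularParametrizationData W N)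
    (hmin : ∀ D' : ModularParametrizationData W N, Dm.modularDegree ≤ D'.modularDegree) :
    ∃ k : ℕ, k ≠ 0 ∧ D₀.modularDegree = k ^ 2 * Dm.modularDegree := by
  -- the two data share newform and lattice
  have hf : D₀.f = Dm.f := D₀.isNewformOf.unique Dm.isNewformOf
  have hL : D₀.L.lattice = Dm.L.lattice := IsNeronLatticeOf.lattice_eq D₀.isNeronLattice Dm.isNeronLattice
  have hcm : Dm.c ≠ 0 := Dm.maninConstant_ne_zero_holds
  have hc₀ : D₀.c ≠ 0 := D₀.maninConstant_ne_zero_holds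
  -- the gcd of the constants is admissible for `Dm`
  set g : ℕ := Int.gcd Dm.c D₀.c with hg
  have hg0 : g ≠ 0 := fun h ↦ hcm (Int.gcd_eq_zero_iff.mp h).1
  have hgz : (g : ℤ) ≠ 0 := by exact_mod_cast hg0
  have hadm : ∀ z ∈ periodLattice Dm.f, ((g : ℤ) : ℂ) * z ∈ Dm.L.lattice := by
    intro z hz
    have h1 : (Dm.c : ℂ) * z ∈ Dm.L.lattice := Dm.smul_periodLattice_le z hz
    have h2 : (D₀.c : ℂ) * z ∈ Dm.L.lattice := by
      rw [← hL]
      exact D₀.smul_periodLattice_le z (hf ▸ hz)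
    have hbez : ((g : ℤ) : ℂ) * z =
        (Int.gcdA Dm.c D₀.c : ℤ) • ((Dm.c : ℂ) * z) + (Int.gcdB Dm.c D₀.c : ℤ) • ((D₀.c : ℂ) * z) := by
      rw [hg, Int.gcd_eq_gcd_ab Dm.c D₀.c]
      simp only [zsmul_eq_mul]
      push_cast
      ring
    rw [hbez]
    exact Dm.L.lattice.add_mem (Dm.L.lattice.smul_mem _ h1) (Dm.L.lattice.smul_mem _ h2)
  obtain ⟨Dg, hgf, hgL, -, hgc⟩ := Dm.exists_datum_c_eq hgz hadm
  -- square law against the gcd datum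
  have hdvm : (g : ℤ) ∣ Dm.c := by rw [hg]; exact Int.gcd_dvd_left Dm.c D₀.c
  have hdv₀ : (g : ℤ) ∣ D₀.c := by rw [hg]; exact Int.gcd_dvd_right Dm.c D₀.c
  have hkm : Dm.c / g ≠ 0 := fun h ↦ hcm (by rw [← Int.ediv_mul_cancel hdvm, h, zero_mul])
  have hk₀ : D₀.c / g ≠ 0 := fun h ↦ hc₀ (by rw [← Int.ediv_mul_cancel hdv₀, h, zero_mul])
  have hm : Dm.deg = (Dm.c / g).natAbs ^ 2 * Dg.deg :=
    MinimalBelow.deg_eq_natAbs_sq_mul_deg Dg Dm hgf.symm (by rw [hgL]) hkm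
      (by rw [hgc, Int.ediv_mul_cancel hdvm])
  have h₀ : D₀.deg = (D₀.c / g).natAbs ^ 2 * Dg.deg :=
    MinimalBelow.deg_eq_natAbs_sq_mul_deg Dg D₀ (hf.trans hgf.symm) (by rw [hL, hgL]) hk₀
      (by rw [hgc, Int.ediv_mul_cancel hdv₀])
  -- minimality: `deg Dm = deg Dg`
  have hle : Dm.deg ≤ Dg.deg := hmin Dg
  have hsq : 1 ≤ (Dm.c / g).natAbs ^ 2 := Nat.one_le_pow _ _ (Nat.pos_of_ne_zero (Int.natAbs_ne_zero.mpr hkm))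
  have heq : Dm.deg = Dg.deg := by
    refine le_antisymm hle ?_
    calc Dg.deg = 1 * Dg.deg := (one_mul _).symm
      _ ≤ (Dm.c / g).natAbs ^ 2 * Dg.deg := Nat.mul_le_mul_right _ hsq
      _ = Dm.deg := hm.symm
  refine ⟨(D₀.c / g).natAbs, Int.natAbs_ne_zero.mpr hk₀, ?_⟩
  show D₀.deg = (D₀.c / g).natAbs ^ 2 * Dm.deg
  rw [heq, h₀]

/-- **The minimal modular degree divides the degree of every datum.** [folklore] -/
theorem MinimalBelow.minModularDegree_dvd (D₀ : ModularParametrizationData W N) :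
    minModularDegree W N ∣ D₀.modularDegree := by
  obtain ⟨Dm, hDm, hmin⟩ := exists_minimal_datum ⟨D₀⟩
  obtain ⟨k, -, hk⟩ := MinimalBelow.exists_modularDegree_eq_sq_mul D₀ Dm hmin
  exact ⟨k ^ 2, by rw [hk, hDm, mul_comm]⟩

/-- **A minimal datum lies below every datum**: its degree divides `deg D₀` and is `≤` every degree.
[folklore] -/
theorem MinimalBelow.exists_minimal_dvd (D₀ : ModularParametrizationData W N) :
    ∃ D : ModularParametrizationData W N, D.modularDegree ∣ D₀.modularDegree ∧
      ∀ D' : ModularParametrizationData W N, D.modularDegree ≤ D'.modularDegree := by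
  obtain ⟨Dm, hDm, hmin⟩ := exists_minimal_datum ⟨D₀⟩
  exact ⟨Dm, hDm ▸ MinimalBelow.minModularDegree_dvd D₀, hmin⟩

end Datum

/-! ## The registered stub `P → P∣` -/

/-- **Stub `stub_polyDegreeBelow_of_polyDegree` of the line `Sketch` (crux stmt-ABC-2046), registered form:
`P → P∣`.** If every semistable globally minimal `W` has SOME datum of degree `≤ C N^κ`, then below EVERY
datum `D₀` of such a `W` there is one (`deg D ∣ deg D₀`, `deg D ≤ C N^κ`): the minimal datum
(`MinimalBelow.exists_minimal_dvd`). [folklore] -/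
theorem stub_polyDegreeBelow_of_polyDegree : (∃ κ C : ℝ, ∀ (W : WeierstrassCurve ℚ) [W.IsElliptic] [W.IsGloballyMinimal] [NeZero (W.conductorNorm ℤ)], W.IsSemistable ℤ → ∃ D : Literature.NumberTheory.EllipticCurves.ModularForms.ModularParametrizationData W (W.conductorNorm ℤ), (D.modularDegree : ℝ) ≤ C * (W.conductorNorm ℤ : ℝ) ^ κ) → ∃ κ C : ℝ, ∀ (W : WeierstrassCurve ℚ) [W.IsElliptic] [W.IsGloballyMinimal] [NeZero (W.conductorNorm ℤ)], W.IsSemistable ℤ → ∀ D₀ : Literature.NumberTheory.EllipticCurves.ModularForms.ModularParametrizationData W (W.conductorNorm ℤ), ∃ D : Literature.NumberTheory.EllipticCurves.ModularForms.ModularParametrizationData W (W.conductorNorm ℤ), D.modularDegree ∣ D₀.modularDegree ∧ (D.modularDegree : ℝ) ≤ C * (W.conductorNorm ℤ : ℝ) ^ κ := by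
  rintro ⟨κ, C, h⟩
  refine ⟨κ, C, ?_⟩
  intro W _ _ _ hW D₀
  obtain ⟨D₁, hD₁⟩ := h W hW
  obtain ⟨D, hdvd, hmin⟩ := MinimalBelow.exists_minimal_dvd D₀
  exact ⟨D, hdvd, le_trans (by exact_mod_cast hmin D₁) hD₁⟩

/-! ## Riders: `P∣` implies each arithmetic stub of the line; exactness of the splitting -/

/-- `P∣ → DEPTH∣`: below every datum a datum all of whose prime powers are `≤ C N^κ`
(`ℓ^{v_ℓ(deg D)} ∣ deg D ≤ C N^κ`). [folklore] -/
theorem MinimalBelow.primePowersBelow_of_polyDegreeBelow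
    (h : ∃ κ C : ℝ, ∀ (W : WeierstrassCurve ℚ) [W.IsElliptic] [W.IsGloballyMinimal] [NeZero (W.conductorNorm ℤ)], W.IsSemistable ℤ → ∀ D₀ : ModularParametrizationData W (W.conductorNorm ℤ), ∃ D : ModularParametrizationData W (W.conductorNorm ℤ), D.modularDegree ∣ D₀.modularDegree ∧ (D.modularDegree : ℝ) ≤ C * (W.conductorNorm ℤ : ℝ) ^ κ) :
    ∃ κ C : ℝ, ∀ (W : WeierstrassCurve ℚ) [W.IsElliptic] [W.IsGloballyMinimal] [NeZero (W.conductorNorm ℤ)], W.IsSemistable ℤ → ∀ D₀ : ModularParametrizationData W (W.conductorNorm ℤ), ∃ D : ModularParametrizationData W (W.conductorNorm ℤ), D.modularDegree ∣ D₀.modularDegree ∧ ∀ ℓ : ℕ, ℓ.Prime → ((ℓ ^ (D.modularDegree).factorization ℓ : ℕ) : ℝ) ≤ C * (W.conductorNorm ℤ : ℝ) ^ κ := by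
  obtain ⟨κ, C, h⟩ := h
  refine ⟨κ, C, ?_⟩
  intro W _ _ _ hW D₀
  obtain ⟨D, hdvd, hD⟩ := h W hW D₀
  refine ⟨D, hdvd, fun ℓ _ ↦ le_trans ?_ hD⟩
  exact_mod_cast Nat.le_of_dvd D.deg_pos (Nat.ordProj_dvd _ _)

/-- `P∣ → DEPTH_A∣` (excess depth, skeleton v3's `stub_excessDepthBelow`): `ℓ^{v−1} ≤ ℓ^v ≤ deg D ≤ C N^κ`.
[folklore] -/
theorem MinimalBelow.excessDepthBelow_of_polyDegreeBelow
    (h : ∃ κ C : ℝ, ∀ (W : WeierstrassCurve ℚ) [W.IsElliptic] [W.IsGloballyMinimal] [NeZero (W.conductorNorm ℤ)], W.IsSemistable ℤ → ∀ D₀ : ModularParametrizationData W (W.conductorNorm ℤ), ∃ D : ModularParametrizationData W (W.conductorNorm ℤ), D.modularDegree ∣ D₀.modularDegree ∧ (D.modularDegree : ℝ) ≤ C * (W.conductorNorm ℤ : ℝ) ^ κ) :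
    ∃ κ C : ℝ, ∀ (W : WeierstrassCurve ℚ) [W.IsElliptic] [W.IsGloballyMinimal] [NeZero (W.conductorNorm ℤ)], W.IsSemistable ℤ → ∀ D₀ : ModularParametrizationData W (W.conductorNorm ℤ), ∃ D : ModularParametrizationData W (W.conductorNorm ℤ), D.modularDegree ∣ D₀.modularDegree ∧ ∀ ℓ ∈ (D.modularDegree).primeFactors, ((ℓ ^ ((D.modularDegree).factorization ℓ - 1) : ℕ) : ℝ) ≤ C * (W.conductorNorm ℤ : ℝ) ^ κ := by
  obtain ⟨κ, C, h⟩ := MinimalBelow.primePowersBelow_of_polyDegreeBelow h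
  refine ⟨κ, C, ?_⟩
  intro W _ _ _ hW D₀
  obtain ⟨D, hdvd, hD⟩ := h W hW D₀
  refine ⟨D, hdvd, fun ℓ hℓ ↦ le_trans ?_ (hD ℓ (Nat.prime_of_mem_primeFactors hℓ))⟩
  exact_mod_cast Nat.pow_le_pow_right (Nat.prime_of_mem_primeFactors hℓ).pos (Nat.sub_le _ _)

/-- `P∣ → COUNT∣` (skeleton v3's `stub_truncatedMassBelow`): the truncated log-mass is at most the full
log-mass `Σ v_ℓ log ℓ = log deg D ≤ log C + κ log N ≤ log (max C 1) + κ log N`. [folklore] -/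
theorem MinimalBelow.truncatedMassBelow_of_polyDegreeBelow
    (h : ∃ κ C : ℝ, ∀ (W : WeierstrassCurve ℚ) [W.IsElliptic] [W.IsGloballyMinimal] [NeZero (W.conductorNorm ℤ)], W.IsSemistable ℤ → ∀ D₀ : ModularParametrizationData W (W.conductorNorm ℤ), ∃ D : ModularParametrizationData W (W.conductorNorm ℤ), D.modularDegree ∣ D₀.modularDegree ∧ (D.modularDegree : ℝ) ≤ C * (W.conductorNorm ℤ : ℝ) ^ κ) :
    ∃ κ C : ℝ, ∀ (W : WeierstrassCurve ℚ) [W.IsElliptic] [W.IsGloballyMinimal] [NeZero (W.conductorNorm ℤ)], W.IsSemistable ℤ → ∀ D₀ : ModularParametrizationData W (W.conductorNorm ℤ), ∃ D : ModularParametrizationData W (W.conductorNorm ℤ), D.modularDegree ∣ D₀.modularDegree ∧ (∑ ℓ ∈ (D.modularDegree).primeFactors, min (((D.modularDegree).factorization ℓ : ℝ) * Real.log ℓ) (Real.log (W.conductorNorm ℤ : ℝ))) ≤ κ * Real.log (W.conductorNorm ℤ : ℝ) + C := by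
  obtain ⟨κ, C, h⟩ := h
  refine ⟨κ, Real.log (max C 1), ?_⟩
  intro W _ _ _ hW D₀
  obtain ⟨D, hdvd, hD⟩ := h W hW D₀
  refine ⟨D, hdvd, ?_⟩
  have hN1 : (1 : ℝ) ≤ (W.conductorNorm ℤ : ℝ) := by
    exact_mod_cast Nat.one_le_iff_ne_zero.mpr (NeZero.ne _)
  have hN0 : (0 : ℝ) < (W.conductorNorm ℤ : ℝ) := lt_of_lt_of_le one_pos hN1
  have hdpos : (0 : ℝ) < (D.modularDegree : ℝ) := by exact_mod_cast D.deg_pos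
  have hB : D.modularDegree ≤ max C 1 * (W.conductorNorm ℤ : ℝ) ^ κ :=
    hD.trans (mul_le_mul_of_nonneg_right (le_max_left _ _) (Real.rpow_nonneg hN0.le κ))
  have hBpos : (0 : ℝ) < max C 1 := lt_of_lt_of_le one_pos (le_max_right _ _)
  calc (∑ ℓ ∈ (D.modularDegree).primeFactors,
          min (((D.modularDegree).factorization ℓ : ℝ) * Real.log ℓ) (Real.log (W.conductorNorm ℤ : ℝ)))
      ≤ ∑ ℓ ∈ (D.modularDegree).primeFactors, ((D.modularDegree).factorization ℓ : ℝ) * Real.log ℓ :=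
        Finset.sum_le_sum fun ℓ _ ↦ min_le_left _ _
    _ = Real.log D.modularDegree := (PolyDegreeOfDepthOfCount.log_eq_sum_factorization _).symm
    _ ≤ Real.log (max C 1 * (W.conductorNorm ℤ : ℝ) ^ κ) := Real.log_le_log hdpos hB
    _ = κ * Real.log (W.conductorNorm ℤ : ℝ) + Real.log (max C 1) := by
        rw [Real.log_mul hBpos.ne' (Real.rpow_pos_of_pos hN0 κ).ne', Real.log_rpow hN0]; ring

/-- **Exactness of the splitting of crux B (skeleton v3 of the line `Sketch`).** Crux B
(`PolyDegreeOfBoundedPrimes = (A → P)`) is EQUIVALENT to `A → DEPTH_A∣ ∧ COUNT∣`, where DEPTH_A∣ and COUNT∣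
are verbatim the two open registered stubs `stub_excessDepthBelow`, `stub_truncatedMassBelow`: `←` is the
skeleton's composition (GLUE-A `stub_primePowersExist_of_degreePrimes_of_excessDepth`, p96116, then GLUE v2
`stub_polyDegree_of_depthExists_of_count`, p87649), `→` is `P → P∣` (the minimal datum) followed by the
riders above. So promoting the two stubs loses nothing: granted A, each is necessary and together they are
sufficient. [folklore] -/
theorem polyDegreeOfBoundedPrimes_iff_excessDepth_and_truncatedMass :
    PolyDegreeOfBoundedPrimes ↔ (DegreePrimesPolyBounded →
      (∃ κ C : ℝ, ∀ (W : WeierstrassCurve ℚ) [W.IsElliptic] [W.IsGloballyMinimal] [NeZero (W.conductorNorm ℤ)], W.IsSemistable ℤ → ∀ D₀ : ModularParametrizationData W (W.conductorNorm ℤ), ∃ D : ModularParametrizationData W (W.conductorNorm ℤ), D.modularDegree ∣ D₀.modularDegree ∧ ∀ ℓ ∈ (D.modularDegree).primeFactors, ((ℓ ^ ((D.modularDegree).factorization ℓ - 1) : ℕ) : ℝ) ≤ C * (W.conductorNorm ℤ : ℝ) ^ κ) ∧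
      (∃ κ C : ℝ, ∀ (W : WeierstrassCurve ℚ) [W.IsElliptic] [W.IsGloballyMinimal] [NeZero (W.conductorNorm ℤ)], W.IsSemistable ℤ → ∀ D₀ : ModularParametrizationData W (W.conductorNorm ℤ), ∃ D : ModularParametrizationData W (W.conductorNorm ℤ), D.modularDegree ∣ D₀.modularDegree ∧ (∑ ℓ ∈ (D.modularDegree).primeFactors, min (((D.modularDegree).factorization ℓ : ℝ) * Real.log ℓ) (Real.log (W.conductorNorm ℤ : ℝ))) ≤ κ * Real.log (W.conductorNorm ℤ : ℝ) + C)) := by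
  constructor
  · intro hB hA
    have hP := stub_polyDegreeBelow_of_polyDegree (hB hA)
    exact ⟨MinimalBelow.excessDepthBelow_of_polyDegreeBelow hP,
      MinimalBelow.truncatedMassBelow_of_polyDegreeBelow hP⟩
  · intro h hA
    obtain ⟨hX, hC⟩ := h hA
    exact stub_polyDegree_of_depthExists_of_count
      (stub_primePowersExist_of_degreePrimes_of_excessDepth hA hX) hC

end Summit.ABC.ABC.Theorems

end
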